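import Summits.ResolutionOfSingularities.KangarooAtlas.MizutaniSpreadTrunc
import Summits.ResolutionOfSingularities.KangarooAtlas.MizutaniMoves
import HarnessLib

/-!
# Mizutani's conjecture `m(e) = 2p^e − 1` — SPREADING, III: the coefficients of the substituted element

Cell topic `Summits/ResolutionOfSingularities/KangarooAtlas` (pub-rosobs); namespace
`Summit.ResolutionOfSingularities.KangarooAtlas.Mizutani`.  Part of the Lean transcription of the
in-house note MIZUTANI-PROOF-g59 (AI-written, AI-audited; *AI review is weaker than expert review*; not a
resolution theorem).  Encloser-1 ARCH-e1 (S1): the note's "no-cancellation lemma" (§5 Theorem D″) for one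
elementary substitution `θ = θ_{j,i,β}`:

* `theta_monomial` — `θ(κ X^M) = Σ_{u ≤ M_j} C(M_j,u) β^u κ · X^{move_{j→i,u} M}`;
* `coeff_theta` — `coeff_N (θ f) = Σ_{u ≤ N_i} κ_{N + u e_j − u e_i} · C(N_j + u, u) · β^u`, i.e. the
  evaluation at `β` of the polynomial `spreadPoly j i f N` (`eval_spreadPoly`), whose `u`-th coefficient is
  `κ_{N + u e_j − u e_i} C(N_j+u, u)` (`coeff_spreadPoly`).

References: [Mizutani1973HironakaGroupSchemes] (Remark 2.10; in-house proof §5 Thm D″).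
-/

open MvPolynomial Literature.AlgebraicGeometry.Resolution

namespace Summit.ResolutionOfSingularities.KangarooAtlas.Mizutani

section ThetaMonomial

variable {ι : Type*} [DecidableEq ι] {k : Type*} [CommRing k]

/-- `θ` fixes monomials not involving `X_j`. [folklore] -/
theorem theta_monomial_of_zero (j i : ι) (β : k) {M : ι →₀ ℕ} (hM : M j = 0) (κ : k) :
    theta j i β (monomial M κ) = monomial M κ := by
  unfold theta
  rw [aeval_monomial, monomial_eq]
  congr 1
  refine Finset.prod_congr rfl fun l hl => ?_
  have hlj : l ≠ j := by
    intro h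
    rw [h, Finsupp.mem_support_iff] at hl
    exact hl hM
  simp only [if_neg hlj]

/-- The pure power `X_j^n` under `θ`: the binomial expansion. [folklore] -/
theorem theta_X_pow (j i : ι) (β : k) (n : ℕ) :
    theta j i β (X j ^ n) = ∑ u ∈ Finset.range (n + 1),
      monomial (Finsupp.single j (n - u) + Finsupp.single i u) (((n.choose u : ℕ) : k) * β ^ u) := by
  rw [map_pow, theta_X, if_pos rfl, add_comm, add_pow]
  refine Finset.sum_congr rfl fun u _ => ?_
  rw [mul_pow, ← map_pow, X_pow_eq_monomial, X_pow_eq_monomial, C_mul_monomial, monomial_mul,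
    ← map_natCast (C : k →+* MvPolynomial ι k), mul_comm, C_mul_monomial]
  congr 1
  · rw [add_comm]
  · ring

/-- The exponent bookkeeping of a move: `(M − M_j e_j) + (M_j − u) e_j + u e_i = move_{j→i,u} M`
for `u ≤ M_j`. [folklore] -/
theorem erase_add_single_add_single {j i : ι} (hji : j ≠ i) {M : ι →₀ ℕ} {u : ℕ} (hu : u ≤ M j) :
    Finsupp.erase j M + (Finsupp.single j (M j - u) + Finsupp.single i u) = move j i u M := by
  ext l
  rw [move_apply hji]
  simp only [Finsupp.add_apply]
  by_cases h1 : l = j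
  · subst h1
    rw [if_pos rfl, Finsupp.erase_same, Finsupp.single_eq_same, Finsupp.single_eq_of_ne hji]
    omega
  · rw [if_neg h1, Finsupp.erase_ne h1, Finsupp.single_eq_of_ne h1]
    by_cases h2 : l = i
    · subst h2
      rw [if_pos rfl, Finsupp.single_eq_same]
      omega
    · rw [if_neg h2, Finsupp.single_eq_of_ne h2]
      omega

/-- **`θ` on a monomial**: `θ(κ X^M) = Σ_{u ≤ M_j} C(M_j,u) β^u κ · X^{move_{j→i,u} M}`
(MIZUTANI-PROOF-g59 §5, proof of Thm D″: "(Σ_j A_ij t_j)^{M_i}" expanded; here one substitution).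
[cite: Mizutani1973HironakaGroupSchemes, Remark 2.10 (in-house proof §5 Thm D″)] -/
theorem theta_monomial (j i : ι) (hji : j ≠ i) (β : k) (M : ι →₀ ℕ) (κ : k) :
    theta j i β (monomial M κ) = ∑ u ∈ Finset.range (M j + 1),
      monomial (move j i u M) (κ * ((M j).choose u : ℕ) * β ^ u) := by
  have hsplit : monomial M κ = monomial (Finsupp.erase j M) κ * X j ^ (M j) := by
    rw [X_pow_eq_monomial, monomial_mul, mul_one, Finsupp.erase_add_single]
  rw [hsplit, map_mul, theta_monomial_of_zero j i β (Finsupp.erase_same) κ, theta_X_pow j i β,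
    Finset.mul_sum]
  refine Finset.sum_congr rfl fun u hu => ?_
  rw [monomial_mul, erase_add_single_add_single hji (Nat.lt_succ_iff.mp (Finset.mem_range.mp hu))]
  congr 1
  ring

end ThetaMonomial

/-! ## The coefficient formula -/

section Coeff

variable {ι : Type*} [DecidableEq ι] {k : Type*} [CommRing k]

/-- Coordinates of the inverse move `N + u e_j − u e_i`. [folklore] -/
theorem inverseMove_apply {j i : ι} (hji : j ≠ i) (N : ι →₀ ℕ) (u : ℕ) (l : ι) :
    (N + Finsupp.single j u - Finsupp.single i u) l =
      if l = j then N j + u else if l = i then N i - u else N l := by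
  simp only [Finsupp.tsub_apply, Finsupp.add_apply]
  by_cases h1 : l = j
  · subst h1
    rw [if_pos rfl, Finsupp.single_eq_same, Finsupp.single_eq_of_ne hji, Nat.sub_zero]
  · rw [if_neg h1, Finsupp.single_eq_of_ne h1, add_zero]
    by_cases h2 : l = i
    · subst h2; rw [if_pos rfl, Finsupp.single_eq_same]
    · rw [if_neg h2, Finsupp.single_eq_of_ne h2, Nat.sub_zero]

/-- The `j`-coordinate of the inverse move. [folklore] -/
theorem inverseMove_apply_j {j i : ι} (hji : j ≠ i) (N : ι →₀ ℕ) (u : ℕ) :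
    (N + Finsupp.single j u - Finsupp.single i u) j = N j + u := by
  rw [inverseMove_apply hji, if_pos rfl]

/-- The inverse move: the unique `M` with `move_{j→i,u} M = N` (when `u ≤ M_j`, `u ≤ N_i`). [folklore] -/
theorem move_eq_iff {j i : ι} (hji : j ≠ i) (M N : ι →₀ ℕ) (u : ℕ) (hu : u ≤ M j) :
    move j i u M = N ↔ M = N + Finsupp.single j u - Finsupp.single i u ∧ u ≤ N i := by
  constructor
  · intro h
    have hc : ∀ l, N l = if l = j then M j - u else if l = i then M i + u else M l := fun l => by
      rw [← h, move_apply hji]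
    have hNi : N i = M i + u := by rw [hc i, if_neg hji.symm, if_pos rfl]
    refine ⟨?_, by omega⟩
    ext l
    rw [inverseMove_apply hji]
    by_cases h1 : l = j
    · subst h1; rw [if_pos rfl, hc l, if_pos rfl]; omega
    · rw [if_neg h1]
      by_cases h2 : l = i
      · subst h2; rw [if_pos rfl, hNi]; omega
      · rw [if_neg h2, hc l, if_neg h1, if_neg h2]
  · rintro ⟨h, hNi⟩
    have hc : ∀ l, M l = if l = j then N j + u else if l = i then N i - u else N l := fun l => by
      rw [h, inverseMove_apply hji]
    ext l
    rw [move_apply hji]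
    by_cases h1 : l = j
    · subst h1; rw [if_pos rfl, hc l, if_pos rfl]; omega
    · rw [if_neg h1]
      by_cases h2 : l = i
      · subst h2; rw [if_pos rfl, hc l, if_neg h1, if_pos rfl]; omega
      · rw [if_neg h2, hc l, if_neg h1, if_neg h2]

/-- **The spread polynomial** `P_N(Y) = Σ_{u ≤ N_i} κ_{N + u e_j − u e_i} C(N_j + u, u) Y^u ∈ k[Y]`.
[cite: Mizutani1973HironakaGroupSchemes, Remark 2.10 (in-house proof §5 Thm D″: the coefficient of t^P as a polynomial in A)] -/
noncomputable def spreadPoly (j i : ι) (f : MvPolynomial ι k) (N : ι →₀ ℕ) : Polynomial k :=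
  ∑ u ∈ Finset.range (N i + 1),
    Polynomial.monomial u (coeff (N + Finsupp.single j u - Finsupp.single i u) f * ((N j + u).choose u : ℕ))

omit [DecidableEq ι] in
/-- Coefficients of the spread polynomial. [folklore] -/
theorem coeff_spreadPoly (j i : ι) (f : MvPolynomial ι k) (N : ι →₀ ℕ) (u : ℕ) :
    (spreadPoly j i f N).coeff u = if u ≤ N i then
      coeff (N + Finsupp.single j u - Finsupp.single i u) f * ((N j + u).choose u : ℕ) else 0 := by
  unfold spreadPoly
  rw [Polynomial.finsetSum_coeff]
  simp only [Polynomial.coeff_monomial]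
  rw [Finset.sum_ite_eq']
  simp only [Finset.mem_range, Nat.lt_succ_iff]

omit [DecidableEq ι] in
/-- The spread polynomial has degree `≤ N_i`. [folklore] -/
theorem natDegree_spreadPoly_le (j i : ι) (f : MvPolynomial ι k) (N : ι →₀ ℕ) :
    (spreadPoly j i f N).natDegree ≤ N i := by
  unfold spreadPoly
  refine (Polynomial.natDegree_sum_le _ _).trans ?_
  refine Finset.sup_le fun u hu => ?_
  exact (Polynomial.natDegree_monomial_le _).trans (Nat.lt_succ_iff.mp (Finset.mem_range.mp hu))

/-- **The coefficient formula**: `coeff_N (θ_β f) = P_N(β)` (for `j ≠ i`).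
[cite: Mizutani1973HironakaGroupSchemes, Remark 2.10 (in-house proof §5 Thm D″)] -/
theorem eval_spreadPoly (j i : ι) (hji : j ≠ i) (β : k) (f : MvPolynomial ι k) (N : ι →₀ ℕ) :
    (spreadPoly j i f N).eval β = coeff N (theta j i β f) := by
  -- right-hand side, monomial by monomial
  have hRHS : coeff N (theta j i β f) = ∑ M ∈ f.support, ∑ u ∈ Finset.range (M j + 1),
      if move j i u M = N then coeff M f * ((M j).choose u : ℕ) * β ^ u else 0 := by
    conv_lhs => rw [f.as_sum, map_sum, coeff_sum]
    refine Finset.sum_congr rfl fun M _ => ?_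
    rw [theta_monomial j i hji, coeff_sum]
    refine Finset.sum_congr rfl fun u _ => ?_
    rw [coeff_monomial]
  -- left-hand side
  have hLHS : (spreadPoly j i f N).eval β = ∑ u ∈ Finset.range (N i + 1),
      coeff (N + Finsupp.single j u - Finsupp.single i u) f * ((N j + u).choose u : ℕ) * β ^ u := by
    unfold spreadPoly
    rw [Polynomial.eval_finsetSum]
    refine Finset.sum_congr rfl fun u _ => ?_
    rw [Polynomial.eval_monomial]
  rw [hLHS, hRHS]
  -- rewrite each inner RHS term as a sum over `u ≤ N_i` and swap
  have hinner : ∀ M ∈ f.support,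
      (∑ u ∈ Finset.range (M j + 1),
        if move j i u M = N then coeff M f * ((M j).choose u : ℕ) * β ^ u else 0) =
      ∑ u ∈ Finset.range (N i + 1),
        if M = N + Finsupp.single j u - Finsupp.single i u then
          coeff (N + Finsupp.single j u - Finsupp.single i u) f * ((N j + u).choose u : ℕ) * β ^ u
        else 0 := by
    intro M _
    -- both sides have the single possibly non-zero term `u` with `move_{j→i,u} M = N`, `u ≤ M_j`
    rw [← Finset.sum_filter, ← Finset.sum_filter]
    refine Finset.sum_bij (fun u _ => u) ?_ ?_ ?_ ?_
    · intro u hu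
      rw [Finset.mem_filter, Finset.mem_range, Nat.lt_succ_iff] at hu ⊢
      have h := (move_eq_iff hji M N u hu.1).mp hu.2
      exact ⟨h.2, h.1⟩
    · intro u _ v _ h; exact h
    · intro v hv
      rw [Finset.mem_filter, Finset.mem_range, Nat.lt_succ_iff] at hv
      have hvM : v ≤ M j := by rw [hv.2, inverseMove_apply_j hji]; omega
      refine ⟨v, ?_, rfl⟩
      rw [Finset.mem_filter, Finset.mem_range, Nat.lt_succ_iff]
      exact ⟨hvM, (move_eq_iff hji M N v hvM).mpr ⟨hv.2, hv.1⟩⟩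
    · intro u hu
      rw [Finset.mem_filter, Finset.mem_range, Nat.lt_succ_iff] at hu
      have h := (move_eq_iff hji M N u hu.1).mp hu.2
      rw [← h.1]
      congr 2
      rw [h.1, inverseMove_apply_j hji]
  rw [Finset.sum_congr rfl hinner, Finset.sum_comm]
  refine Finset.sum_congr rfl fun u _ => ?_
  rw [Finset.sum_ite_eq' f.support]
  split_ifs with hmem
  · rfl
  · rw [notMem_support_iff.mp hmem, zero_mul, zero_mul]

end Coeff

end Summit.ResolutionOfSingularities.KangarooAtlas.Mizutani
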